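import Summits.QuantumFields.BalabanUV.Beta.RemainderExplicitHistoryDiagonalWeights

/-!
# RemainderExplicitHistoryDiagonalTwoRun — ROAD P3, STATION S-d4p3-g48-1, SECOND FILE: TWO RUNS OF THE ORDER-0 PROFILE FAMILY WHOSE
# CUTOFFS DIFFER BY `n` STEPS, matched by infrared distance — the EXACT matched recursion with shift `n`, the maximum principle with
# shift `n`, and THE SANDWICH `src∕(1 + Wγ∕b) ≲ max_j d_j ≤ src∕(1 − Wγ∕b)` between the matched discrepancies `d_j = 1∕(g^B_{j+n})² − 1∕(g^A_j)²`
# and the longer run's EXTRA-HISTORY SOURCE `src = Σ_{j<K} Σ_{i<n} ρ(j+n−i)·(g^B_{j+n} − g^B_i)` (the `n` ultraviolet ages the short run lacks)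

Cell `pub-balaban`, β-function sub-cell, BINDER row D4 «RemainderConst leaves for Bałaban's split» (`HOME/BINDER-OWNERS.md`; owner
lineage `b2b-balaban-beta-an4`; this file by co-owner #3 lineage `b2b-balaban-beta-d4-p3`, road P3 «the reduction road», generation 48,
station S-d4p3-g48-1 «the cutoff discrepancy of the continuum coupling: two-sided law», second file; imports the station's first file
`RemainderExplicitHistoryDiagonalWeights`), β-FLOW TEAM duty (1);
FREEZE (0) honoured (def-free module in road P3's own `RemainderExplicit*` series; no leaf, no interface, no Literature file).  SOURCE
OF THE SHAPES ONLY: [Balaban1987RG1] (0.20) p. 256, (0.31) and Thm 2 p. 259, §5 p. 298.  Pure real analysis.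

HONEST FRAMING (page 1 of everything the β sub-cell writes).  *"Discharging BetaPertH makes Bałaban's UV stability UNCONDITIONAL —
a real constructive-QFT result; it is NOT the continuum limit and NOT the Clay problem."*  THIS FILE DISCHARGES NOTHING OF THE
KIND.  It is [folklore] real analysis about ONE explicit toy family (ours), road P3's ORDER-0 PROFILE FAMILY
`β_{k+1} = b + Σ_{i≤k} ρ(k−i)·min(g_k, |g_k − g_i|)` (generation 44), whose memory PROFILE `ρ ≥ 0` is merely summable (`Σ_{a<N} ρ_a ≤ W`).
Nothing of Bałaban's (1.22) is asserted or constructed; row D4 class UNCHANGED (critical-path width 0; instance 0∕1; D4 DISCHARGE NO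
DATE); NOT B12 Thm 2, NOT BetaPertH, NOT continuum, NOT Clay.  HONEST DEPENDENCY: continuum YM on T⁴ ⇐ BetaPertH ∧ nine spine
estimates (0/9 proved); BetaPertH ⇐ (D1) ∧ (D4) ∧ CAP+tail; G-an2-4 gates asym, D1 and NE2/3/4.  ABSOLUTE RULE: nothing is cited as a
fact.  All letters NOT-IN-PRINT; `BetaFlowAsPrinted S` records a Markov β_n only ⇒ no junction of the as-printed interface changes.

THE STATION'S QUESTION (generation 47's census, `RemainderExplicitHistoryDiagonalMonotone.hasSum_disc`): for a pinned family of runs the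
diagonal discrepancy series has sum `Q(m) := astar g m − invSq g m 0` (continuum recursion variable `m` scales above the pin MINUS the
ultraviolet end of the run with exactly `m` steps); WHEN is `sup_m Q(m) < ∞`?  Generation 47 conjectured «iff `Σ_a a·ρ(a) < ∞`» from numerics.
THE STATION'S ANSWER: `Q(m) ≍ m^{−3∕2}·Σ_a ρ(a)·min(a,m)²` (two-sided — the lower side for the running maximum `max_{m′≤m} Q(m′)` —
with constants in `b, γ, W, g_IR`; the upper side under `Wγ < b`), so `sup_m Q(m) < ∞` iff `Σ_a ρ(a)·min(a,m)² = O(m^{3∕2})`; a bounded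
HALF moment `Σ_a ρ(a)√a` suffices (the first moment is not needed and even gives decay `O(m^{−1∕2})`); for `ρ(a) ≍ a^{−p}` the criterion
reads `p ≥ 3∕2` (kernel text: the borderline `p = 3∕2` and a sparse violating profile in the annex `…DiagonalExamples`, `p > 3∕2` through
the half moment) — the conjectured first-moment threshold `p > 2` is not the true one.

WHAT IS PROVED HERE ([folklore]; 0 sorry; 0 `def`; the family as the hypothesis `hβ` on an abstract `β : FlowStep.HBeta`, `ρ ≥ 0`, `b > 0`).
* §1 `beta_prefix_run_range`; **`disc_signed_step_shift`** — for runs A (`K` steps) and B (`K + n` steps), `j < K`: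
  `1∕(g^A_j)² − 1∕(g^B_{j+n})² = (1∕(g^A_{j+1})² − 1∕(g^B_{j+n+1})²) − Σ_{i<n} ρ(j+n−i)(g^B_{j+n} − g^B_i) − Σ_{i≤j} ρ(j−i)((g^B_{j+n} −
g^A_j) − (g^B_{i+n} − g^A_i))`
  (the ninth file's `disc_signed_step` is `n = 1`); **`invSq_le_invSq_shift_run`** (MAXIMUM PRINCIPLE with shift: pinned `g^A_K = g^B_{K+n}` ⟹
  `1∕(g^A_j)² ≤ 1∕(g^B_{j+n})²` for all `j ≤ K`).
* §2 **`shift_disc_le_src`** (UPPER: under `Wγ < b`, `0 ≤ d_j ≤ src∕(1 − Wγ∕b)` for all `j ≤ K` — backward accumulation from the pin; the common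
  ages feed back through `e_i = g^A_i − g^B_{i+n} ≤ (g^A_i)³∕2·d_i` and `Σ_{i<K} (g^A_i)³ ≤ 2γ∕b`), **`src_le_shift_disc`** (LOWER, NO smallness:
  any bound `C` on the `d_j` gives `src ≤ d_0 + (Wγ∕b)·C`).
The family-level read-outs (cutoffs `m` and `n + m` of one pinned family; the limit `n → ∞`) are in the station's fourth file.
-/

noncomputable section

open Finset Filter Topology

namespace Summit.QuantumFields.BalabanUV.Beta.RemainderExplicitHistoryDiagonalTwoRun

open Literature.MathematicalPhysics.QuantumFieldTheory.Balaban1983to89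
open Literature.MathematicalPhysics.QuantumFieldTheory.Balaban1983to89.FlowStep
open Literature.MathematicalPhysics.QuantumFieldTheory.Balaban1983to89.T4CouplingMatching
open Literature.MathematicalPhysics.QuantumFieldTheory.Balaban1983to89.T4ContinuumCoupling
open Summit.QuantumFields.BalabanUV.Beta.RemainderExplicitHistoryDiagonalMonotone
open Summit.QuantumFields.BalabanUV.Beta.RemainderExplicitHistoryDiagonalWeights

variable {β : HBeta} {b γ W : ℝ} {ρ : ℕ → ℝ}

/-! ## §1 Two runs whose cutoffs differ by `n` steps: the exact matched recursion and the maximum principle -/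

/-- `beta_prefix_run` with a `range` sum: on a run, `β j (g_0..g_j) = b + Σ_{i<j+1} ρ(j−i)·(g_j − g_i)`. [folklore] -/
theorem beta_prefix_run_range
    (hβ : ∀ (k : ℕ) (p : Fin (k + 1) → ℝ),
      β k p = b + ∑ i : Fin (k + 1), ρ (k - i) * min (p (Fin.last k)) (|p (Fin.last k) - p i|))
    (hb : 0 < b) (hρ0 : ∀ a, 0 ≤ ρ a) {K : ℕ} {g : ℕ → ℝ} (h : RGEqH K β g) (hpos : ∀ k, k ≤ K → 0 < g k)
    {j : ℕ} (hj : j ≤ K) :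
    β j (prefixOf g j) = b + ∑ i ∈ range (j + 1), ρ (j - i) * (g j - g i) := by
  rw [beta_prefix_run hβ hb hρ0 h hpos hj, Fin.sum_univ_eq_sum_range (fun i => ρ (j - i) * (g j - g i)) (j + 1)]

/-- **THE EXACT MATCHED RECURSION WITH SHIFT `n`** for two runs of the family (A: `K` steps, B: `K + n` steps, positive couplings),
matched by infrared distance (`g^A_j ↔ g^B_{j+n}`): for `j < K`,
`1∕(g^A_j)² − 1∕(g^B_{j+n})² = (1∕(g^A_{j+1})² − 1∕(g^B_{j+n+1})²) − Σ_{i<n} ρ(j+n−i)·(g^B_{j+n} − g^B_i)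
  − Σ_{i<j+1} ρ(j−i)·((g^B_{j+n} − g^A_j) − (g^B_{i+n} − g^A_i))` —
(0.20) for both runs, the resolved `min`, the `n` EXTRA ultraviolet ages of B, and the common ages. (`n = 1`: the ninth file's
`disc_signed_step`.) [cite: Balaban1987RG1, (0.20) p.256] -/
theorem disc_signed_step_shift
    (hβ : ∀ (k : ℕ) (p : Fin (k + 1) → ℝ),
      β k p = b + ∑ i : Fin (k + 1), ρ (k - i) * min (p (Fin.last k)) (|p (Fin.last k) - p i|))
    (hb : 0 < b) (hρ0 : ∀ a, 0 ≤ ρ a) {K n : ℕ} {gA gB : ℕ → ℝ} (hA : RGEqH K β gA) (hB : RGEqH (K + n) β gB)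
    (hApos : ∀ k, k ≤ K → 0 < gA k) (hBpos : ∀ k, k ≤ K + n → 0 < gB k) {j : ℕ} (hj : j < K) :
    1 / (gA j) ^ 2 - 1 / (gB (j + n)) ^ 2
      = (1 / (gA (j + 1)) ^ 2 - 1 / (gB (j + n + 1)) ^ 2)
        - (∑ i ∈ range n, ρ (j + n - i) * (gB (j + n) - gB i))
        - ∑ i ∈ range (j + 1), ρ (j - i) * ((gB (j + n) - gA j) - (gB (i + n) - gA i)) := by
  have eA := hA j hj
  have eB := hB (j + n) (by omega)
  rw [beta_prefix_run_range hβ hb hρ0 hA hApos hj.le] at eA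
  rw [beta_prefix_run_range hβ hb hρ0 hB hBpos (by omega : j + n ≤ K + n)] at eB
  have hsplit : ∑ i ∈ range (j + n + 1), ρ (j + n - i) * (gB (j + n) - gB i)
      = (∑ i ∈ range n, ρ (j + n - i) * (gB (j + n) - gB i))
        + ∑ i ∈ range (j + 1), ρ (j - i) * (gB (j + n) - gB (i + n)) := by
    rw [← Finset.sum_range_add_sum_Ico _ (by omega : n ≤ j + n + 1), Finset.sum_Ico_eq_sum_range,
      show j + n + 1 - n = j + 1 by omega]
    congr 1
    refine Finset.sum_congr rfl fun i _ => ?_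
    rw [show j + n - (n + i) = j - i by omega, Nat.add_comm n i]
  rw [hsplit] at eB
  have e3 : ∑ i ∈ range (j + 1), ρ (j - i) * ((gB (j + n) - gA j) - (gB (i + n) - gA i))
      = (∑ i ∈ range (j + 1), ρ (j - i) * (gB (j + n) - gB (i + n)))
        - ∑ i ∈ range (j + 1), ρ (j - i) * (gA j - gA i) := by
    rw [← Finset.sum_sub_distrib]
    exact Finset.sum_congr rfl fun i _ => by ring
  rw [e3, eA, eB]
  ring

/-- **MONOTONE IN THE CUTOFF, SHIFT `n` (maximum principle).**  Two runs of the order-0 profile family (`b > 0`, `ρ ≥ 0`) — A: `K` steps,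
B: `K + n` steps, positive couplings — pinned `g^A_K = g^B_{K+n}`: THEN `1∕(g^A_j)² ≤ 1∕(g^B_{j+n})²` for every `j ≤ K` (at an argmax of
`d = 1∕(g^A)² − 1∕(g^B_{·+n})²` with `d ≥ 0` the exact recursion gives `d_j ≤ d_{j+1}` — the extra-history term is `≤ 0`, every common-age
term too by `coupling_gap_monotone` — so a positive maximum would propagate to the pin, where `d_K = 0`).
[cite: Balaban1987RG1, (0.20) p.256 and Thm 2 p.259] -/
theorem invSq_le_invSq_shift_run
    (hβ : ∀ (k : ℕ) (p : Fin (k + 1) → ℝ),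
      β k p = b + ∑ i : Fin (k + 1), ρ (k - i) * min (p (Fin.last k)) (|p (Fin.last k) - p i|))
    (hb : 0 < b) (hρ0 : ∀ a, 0 ≤ ρ a) {K n : ℕ} {gA gB : ℕ → ℝ} (hA : RGEqH K β gA) (hB : RGEqH (K + n) β gB)
    (hApos : ∀ k, k ≤ K → 0 < gA k) (hBpos : ∀ k, k ≤ K + n → 0 < gB k) (hpin : gA K = gB (K + n)) :
    ∀ j, j ≤ K → 1 / (gA j) ^ 2 ≤ 1 / (gB (j + n)) ^ 2 := by
  classical
  set d : ℕ → ℝ := fun j => 1 / (gA j) ^ 2 - 1 / (gB (j + n)) ^ 2 with hd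
  have hdK : d K = 0 := by simp [hd, hpin]
  have hstep : ∀ j, j < K → (∀ i, i ≤ K → d i ≤ d j) → 0 ≤ d j → d j ≤ d (j + 1) := by
    intro j hj hmax hdj
    have e := disc_signed_step_shift hβ hb hρ0 hA hB hApos hBpos hj
    have hs : 0 ≤ ∑ i ∈ range n, ρ (j + n - i) * (gB (j + n) - gB i) := by
      refine Finset.sum_nonneg fun i hi => mul_nonneg (hρ0 _) ?_
      have hi' : i < n := Finset.mem_range.mp hi
      linarith [run_mono_orderZero hβ hb hρ0 hB hBpos (show i ≤ j + n by omega) (by omega)]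
    have hsum : 0 ≤ ∑ i ∈ range (j + 1), ρ (j - i) * ((gB (j + n) - gA j) - (gB (i + n) - gA i)) := by
      refine Finset.sum_nonneg fun i hi => mul_nonneg (hρ0 _) ?_
      have hi' : i ≤ j := Nat.lt_succ_iff.mp (Finset.mem_range.mp hi)
      have hgap := coupling_gap_monotone (hApos i (by omega)) (hBpos (i + n) (by omega))
        (run_mono_orderZero hβ hb hρ0 hA hApos hi' hj.le)
        (run_mono_orderZero hβ hb hρ0 hB hBpos (by omega : i + n ≤ j + n) (by omega))
        (hmax i (by omega)) hdj
      linarith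
    show 1 / gA j ^ 2 - 1 / gB (j + n) ^ 2 ≤ 1 / gA (j + 1) ^ 2 - 1 / gB (j + 1 + n) ^ 2
    rw [e, Nat.add_right_comm j 1 n]
    linarith
  obtain ⟨j₀, hj₀, hmax₀⟩ := Finset.exists_max_image (range (K + 1)) d ⟨0, by simp⟩
  have hj₀K : j₀ ≤ K := Nat.lt_succ_iff.mp (Finset.mem_range.mp hj₀)
  have hmax : ∀ i, i ≤ K → d i ≤ d j₀ := fun i hi => hmax₀ i (Finset.mem_range.mpr (Nat.lt_succ_of_le hi))
  by_cases hpos : d j₀ ≤ 0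
  · intro j hj
    have := (hmax j hj).trans hpos
    show 1 / gA j ^ 2 ≤ 1 / gB (j + n) ^ 2
    simp only [hd] at this
    linarith
  · rw [not_le] at hpos
    have hprop : ∀ t, j₀ + t ≤ K → d j₀ ≤ d (j₀ + t) := by
      intro t
      induction t with
      | zero => intro _; simp
      | succ t ih =>
        intro ht
        have hjt : j₀ + t < K := by omega
        have h1 := ih hjt.le
        have hmax' : ∀ i, i ≤ K → d i ≤ d (j₀ + t) := fun i hi => (hmax i hi).trans h1
        have h2 := hstep (j₀ + t) hjt hmax' (hpos.le.trans h1)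
        rw [Nat.add_succ]
        exact h1.trans h2
    have hK := hprop (K - j₀) (by omega)
    rw [Nat.add_sub_cancel' hj₀K, hdK] at hK
    exact absurd hK (not_le.mpr hpos)


/-! ## §2 The sandwich: the cutoff discrepancy against the run-level EXTRA-HISTORY SOURCE -/

/-- **UPPER HALF OF THE SANDWICH.**  Two runs of the order-0 profile family in ]0,γ] (`b > 0`, `ρ ≥ 0`, `Σ_{a<N} ρ_a ≤ W`, `Wγ < b`) —
A: `K` steps, B: `K + n` steps — pinned `g^A_K = g^B_{K+n}`.  THEN at every matched scale `j ≤ K`: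
`0 ≤ 1∕(g^B_{j+n})² − 1∕(g^A_j)² ≤ src ∕ (1 − Wγ∕b)`, where `src = Σ_{j<K} Σ_{i<n} ρ(j+n−i)·(g^B_{j+n} − g^B_i)` is B's EXTRA-HISTORY
SOURCE (the `n` ultraviolet ages A does not have, read on the run B; exact, `≥ 0`).  (Backward accumulation from the pin; the common
ages feed back through `e_i = g^A_i − g^B_{i+n} ≤ (g^A_i)³∕2·d_i` and `Σ_{i<K} (g^A_i)³ ≤ 2γ∕b`, so the maximal `d` obeys
`D ≤ src + (Wγ∕b)·D`.) [cite: Balaban1987RG1, (0.20) p.256, (0.31) and Thm 2 p.259] -/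
theorem shift_disc_le_src
    (hβ : ∀ (k : ℕ) (p : Fin (k + 1) → ℝ),
      β k p = b + ∑ i : Fin (k + 1), ρ (k - i) * min (p (Fin.last k)) (|p (Fin.last k) - p i|))
    (hb : 0 < b) (hγ : 0 < γ) (hρ0 : ∀ a, 0 ≤ ρ a) (hρW : ∀ n, ∑ a ∈ range n, ρ a ≤ W) (hsmall : W * γ < b)
    {K n : ℕ} {gA gB : ℕ → ℝ} (hA : RGEqH K β gA) (hB : RGEqH (K + n) β gB)
    (hAbox : ∀ k, k ≤ K → 0 < gA k ∧ gA k ≤ γ) (hBbox : ∀ k, k ≤ K + n → 0 < gB k ∧ gB k ≤ γ)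
    (hpin : gA K = gB (K + n)) :
    ∀ j, j ≤ K → 0 ≤ 1 / (gB (j + n)) ^ 2 - 1 / (gA j) ^ 2 ∧ 1 / (gB (j + n)) ^ 2 - 1 / (gA j) ^ 2
      ≤ (∑ j ∈ range K, ∑ i ∈ range n, ρ (j + n - i) * (gB (j + n) - gB i)) / (1 - W * γ / b) := by
  classical
  have hApos : ∀ k, k ≤ K → 0 < gA k := fun k hk => (hAbox k hk).1
  have hBpos : ∀ k, k ≤ K + n → 0 < gB k := fun k hk => (hBbox k hk).1
  have hlo : BetaLowerH b γ β :=
    RemainderExplicitHistoryHalfMomentWitness.lower (γ := γ) (lam := fun k i => ρ (k - i)) hβ (fun k i => hρ0 _)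
  have hW : 0 ≤ W := by simpa using hρW 0
  set d : ℕ → ℝ := fun j => 1 / (gB (j + n)) ^ 2 - 1 / (gA j) ^ 2 with hd
  set E : ℕ → ℝ := fun j => ∑ i ∈ range n, ρ (j + n - i) * (gB (j + n) - gB i) with hE
  set e : ℕ → ℝ := fun i => gA i - gB (i + n) with he
  have hdom := invSq_le_invSq_shift_run hβ hb hρ0 hA hB hApos hBpos hpin
  have hdnn : ∀ j, j ≤ K → 0 ≤ d j := fun j hj => by
    have := hdom j hj
    simp only [hd]; linarith
  have hBA : ∀ i, i ≤ K → gB (i + n) ≤ gA i := fun i hi =>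
    le_of_one_div_sq_le (hApos i hi) (hBpos (i + n) (by omega)) (hdom i hi)
  have henn : ∀ i, i ≤ K → 0 ≤ e i := fun i hi => by simp only [he]; linarith [hBA i hi]
  have hEnn : ∀ j, j ≤ K → 0 ≤ E j := fun j hj => Finset.sum_nonneg fun i hi => mul_nonneg (hρ0 _) (by
    have hi' : i < n := Finset.mem_range.mp hi
    linarith [run_mono_orderZero hβ hb hρ0 hB hBpos (show i ≤ j + n by omega) (by omega)])
  have he_le : ∀ i, i ≤ K → e i ≤ (gA i) ^ 3 / 2 * d i := fun i hi =>
    gap_le_cube_mul (hBpos (i + n) (by omega)) (hBA i hi)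
  -- the recursion with the common ages' feedback bounded by `Σ ρ(j−i)·e_i`
  have hrec : ∀ j, j < K → d j ≤ d (j + 1) + (E j + ∑ i ∈ range (j + 1), ρ (j - i) * e i) := by
    intro j hj
    have eq := disc_signed_step_shift hβ hb hρ0 hA hB hApos hBpos hj
    rw [Nat.add_right_comm j n 1] at eq
    have hdrop : ∑ i ∈ range (j + 1), ρ (j - i) * ((gB (j + n) - gA j) - (gB (i + n) - gA i))
        ≤ ∑ i ∈ range (j + 1), ρ (j - i) * e i := by
      refine Finset.sum_le_sum fun i _ => mul_le_mul_of_nonneg_left ?_ (hρ0 _)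
      simp only [he]; linarith [henn j hj.le]
    simp only [hd, hE]
    linarith
  have hdK : d K ≤ 0 := by simp [hd, hpin]
  have hacc := backward_sum hdK hrec
  -- the maximum of `d` over the matched scales
  obtain ⟨j₀, hj₀, hmax₀⟩ := Finset.exists_max_image (range (K + 1)) d ⟨0, by simp⟩
  have hj₀K : j₀ ≤ K := Nat.lt_succ_iff.mp (Finset.mem_range.mp hj₀)
  have hmax : ∀ i, i ≤ K → d i ≤ d j₀ := fun i hi => hmax₀ i (Finset.mem_range.mpr (Nat.lt_succ_of_le hi))
  have hD0 : 0 ≤ d j₀ := hdnn j₀ hj₀K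
  -- the feedback sum is at most `(Wγ∕b)·max d`
  have hfeed : ∑ j ∈ range K, ∑ i ∈ range (j + 1), ρ (j - i) * e i ≤ W * γ / b * d j₀ := by
    have hswap : ∑ j ∈ range K, ∑ i ∈ range (j + 1), ρ (j - i) * e i
        = ∑ i ∈ range K, ∑ j ∈ Ico i K, ρ (j - i) * e i := by
      simp only [Finset.range_eq_Ico]
      exact (Finset.sum_Ico_Ico_comm 0 K (fun i j => ρ (j - i) * e i)).symm
    rw [hswap]
    calc ∑ i ∈ range K, ∑ j ∈ Ico i K, ρ (j - i) * e i
        = ∑ i ∈ range K, e i * ∑ a ∈ range (K - i), ρ a := by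
          refine Finset.sum_congr rfl fun i _ => ?_
          rw [Finset.sum_Ico_eq_sum_range, Finset.mul_sum]
          refine Finset.sum_congr rfl fun a _ => ?_
          rw [Nat.add_sub_cancel_left, mul_comm]
      _ ≤ ∑ i ∈ range K, (gA i) ^ 3 / 2 * d j₀ * W := by
          refine Finset.sum_le_sum fun i hi => ?_
          have hi' : i ≤ K := (Finset.mem_range.mp hi).le
          have hgA := hApos i hi'
          have h4 : 0 ≤ (gA i) ^ 3 / 2 := by positivity
          have h1 : e i ≤ (gA i) ^ 3 / 2 * d j₀ :=
            (he_le i hi').trans (mul_le_mul_of_nonneg_left (hmax i hi') h4)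
          have h3 : 0 ≤ ∑ a ∈ range (K - i), ρ a := Finset.sum_nonneg fun a _ => hρ0 a
          calc e i * ∑ a ∈ range (K - i), ρ a ≤ (gA i) ^ 3 / 2 * d j₀ * ∑ a ∈ range (K - i), ρ a :=
                mul_le_mul_of_nonneg_right h1 h3
            _ ≤ (gA i) ^ 3 / 2 * d j₀ * W := mul_le_mul_of_nonneg_left (hρW _) (mul_nonneg h4 hD0)
      _ = d j₀ * W / 2 * ∑ i ∈ range K, (gA i) ^ 3 := by
          rw [Finset.mul_sum]
          exact Finset.sum_congr rfl fun i _ => by ring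
      _ ≤ d j₀ * W / 2 * (2 * γ / b) := by
          refine mul_le_mul_of_nonneg_left ?_ (by positivity)
          calc ∑ i ∈ range K, (gA i) ^ 3 ≤ ∑ i ∈ range K, 1 / (sprof γ b (K - i)) ^ 2 * (1 / sprof γ b (K - i)) :=
                Finset.sum_le_sum fun i hi => cube_le_weight hγ hb hA hAbox hlo (Finset.mem_range.mp hi).le
            _ ≤ 2 * γ / b := sum_weights_lt_le hγ hb K
      _ = W * γ / b * d j₀ := by ring
  -- every `d_j ≤ src + (Wγ∕b)·max d`
  have hall : ∀ j, j ≤ K → d j ≤ (∑ j ∈ range K, E j) + W * γ / b * d j₀ := by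
    intro j hj
    have h1 := hacc j hj
    have h2 : ∑ i ∈ Ico j K, (E i + ∑ i' ∈ range (i + 1), ρ (i - i') * e i')
        ≤ ∑ i ∈ range K, (E i + ∑ i' ∈ range (i + 1), ρ (i - i') * e i') := by
      refine Finset.sum_le_sum_of_subset_of_nonneg (fun i hi => Finset.mem_range.mpr (Finset.mem_Ico.mp hi).2) ?_
      intro i hi _
      have hi' : i ≤ K := (Finset.mem_range.mp hi).le
      exact add_nonneg (hEnn i hi') (Finset.sum_nonneg fun i' hi'' => mul_nonneg (hρ0 _)
        (henn i' ((Nat.lt_succ_iff.mp (Finset.mem_range.mp hi'')).trans hi')))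
    have h3 : ∑ i ∈ range K, (E i + ∑ i' ∈ range (i + 1), ρ (i - i') * e i')
        = (∑ i ∈ range K, E i) + ∑ i ∈ range K, ∑ i' ∈ range (i + 1), ρ (i - i') * e i' := Finset.sum_add_distrib
    linarith [hfeed]
  have hq : 0 < 1 - W * γ / b := by
    have : W * γ / b < 1 := by rw [div_lt_one hb]; exact hsmall
    linarith
  have hDle : d j₀ ≤ (∑ j ∈ range K, E j) / (1 - W * γ / b) := by
    rw [le_div_iff₀ hq]
    have := hall j₀ hj₀K
    nlinarith
  intro j hj
  exact ⟨hdnn j hj, (hmax j hj).trans hDle⟩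

/-- **LOWER HALF OF THE SANDWICH** (no smallness).  Same two pinned runs; if `C` bounds the matched discrepancies
`1∕(g^B_{j+n})² − 1∕(g^A_j)²` for all `j ≤ K`, THEN B's extra-history source is at most the ultraviolet-end discrepancy plus the
feedback: `src ≤ (1∕(g^B_n)² − 1∕(g^A_0)²) + (Wγ∕b)·C` (exact telescoping from the pin; the common ages' term is `≥ −W·e_j`, and
`Σ_{j<K} e_j ≤ (γ∕b)·C`). [cite: Balaban1987RG1, (0.20) p.256, (0.31) and Thm 2 p.259] -/
theorem src_le_shift_disc
    (hβ : ∀ (k : ℕ) (p : Fin (k + 1) → ℝ),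
      β k p = b + ∑ i : Fin (k + 1), ρ (k - i) * min (p (Fin.last k)) (|p (Fin.last k) - p i|))
    (hb : 0 < b) (hγ : 0 < γ) (hρ0 : ∀ a, 0 ≤ ρ a) (hρW : ∀ n, ∑ a ∈ range n, ρ a ≤ W)
    {K n : ℕ} {gA gB : ℕ → ℝ} (hA : RGEqH K β gA) (hB : RGEqH (K + n) β gB)
    (hAbox : ∀ k, k ≤ K → 0 < gA k ∧ gA k ≤ γ) (hBbox : ∀ k, k ≤ K + n → 0 < gB k ∧ gB k ≤ γ)
    (hpin : gA K = gB (K + n)) {C : ℝ} (hC : ∀ j, j ≤ K → 1 / (gB (j + n)) ^ 2 - 1 / (gA j) ^ 2 ≤ C) :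
    ∑ j ∈ range K, ∑ i ∈ range n, ρ (j + n - i) * (gB (j + n) - gB i)
      ≤ (1 / (gB n) ^ 2 - 1 / (gA 0) ^ 2) + W * γ / b * C := by
  classical
  have hApos : ∀ k, k ≤ K → 0 < gA k := fun k hk => (hAbox k hk).1
  have hBpos : ∀ k, k ≤ K + n → 0 < gB k := fun k hk => (hBbox k hk).1
  have hlo : BetaLowerH b γ β :=
    RemainderExplicitHistoryHalfMomentWitness.lower (γ := γ) (lam := fun k i => ρ (k - i)) hβ (fun k i => hρ0 _)
  have hW : 0 ≤ W := by simpa using hρW 0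
  set d : ℕ → ℝ := fun j => 1 / (gB (j + n)) ^ 2 - 1 / (gA j) ^ 2 with hd
  set E : ℕ → ℝ := fun j => ∑ i ∈ range n, ρ (j + n - i) * (gB (j + n) - gB i) with hE
  set e : ℕ → ℝ := fun i => gA i - gB (i + n) with he
  have hdom := invSq_le_invSq_shift_run hβ hb hρ0 hA hB hApos hBpos hpin
  have hBA : ∀ i, i ≤ K → gB (i + n) ≤ gA i := fun i hi =>
    le_of_one_div_sq_le (hApos i hi) (hBpos (i + n) (by omega)) (hdom i hi)
  have henn : ∀ i, i ≤ K → 0 ≤ e i := fun i hi => by simp only [he]; linarith [hBA i hi]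
  have he_le : ∀ i, i ≤ K → e i ≤ (gA i) ^ 3 / 2 * C := fun i hi =>
    (gap_le_cube_mul (hBpos (i + n) (by omega)) (hBA i hi)).trans
      (mul_le_mul_of_nonneg_left (hC i hi) (by have := hApos i hi; positivity))
  have hC0 : 0 ≤ C := by
    have h0 := hdom 0 (Nat.zero_le K)
    have := hC 0 (Nat.zero_le K)
    simp only [Nat.zero_add] at h0 this
    linarith
  -- per scale: `E_j ≤ (d_j − d_{j+1}) + W·e_j`
  have hstep : ∀ j, j < K → E j ≤ (d j - d (j + 1)) + W * e j := by
    intro j hj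
    have eq := disc_signed_step_shift hβ hb hρ0 hA hB hApos hBpos hj
    rw [Nat.add_right_comm j n 1] at eq
    have hlow : -(W * e j) ≤ ∑ i ∈ range (j + 1), ρ (j - i) * ((gB (j + n) - gA j) - (gB (i + n) - gA i)) := by
      have hW' : ∑ i ∈ range (j + 1), ρ (j - i) ≤ W := by
        have h' : ∑ i ∈ range (j + 1), ρ (j - i) = ∑ i ∈ range (j + 1), ρ i := by
          rw [← Finset.sum_range_reflect ρ (j + 1)]
          refine Finset.sum_congr rfl fun i hi => ?_
          have hi' := Finset.mem_range.mp hi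
          rw [show j + 1 - 1 - i = j - i by omega]
        rw [h']
        exact hρW (j + 1)
      calc -(W * e j) ≤ -((∑ i ∈ range (j + 1), ρ (j - i)) * e j) := by
            have := henn j hj.le; nlinarith
        _ = ∑ i ∈ range (j + 1), ρ (j - i) * (-(e j)) := by rw [Finset.sum_mul, ← Finset.sum_neg_distrib]; exact Finset.sum_congr rfl fun i _ => by ring
        _ ≤ ∑ i ∈ range (j + 1), ρ (j - i) * ((gB (j + n) - gA j) - (gB (i + n) - gA i)) := by
            refine Finset.sum_le_sum fun i hi => mul_le_mul_of_nonneg_left ?_ (hρ0 _)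
            have hi' : i ≤ j := Nat.lt_succ_iff.mp (Finset.mem_range.mp hi)
            simp only [he]; linarith [henn i (hi'.trans hj.le)]
    simp only [hd, hE]
    linarith
  have htel : ∑ j ∈ range K, (d j - d (j + 1)) = d 0 - d K := Finset.sum_range_sub' d K
  have hdK : d K = 0 := by simp [hd, hpin]
  have hsum_e : ∑ j ∈ range K, e j ≤ γ / b * C := by
    calc ∑ j ∈ range K, e j ≤ ∑ j ∈ range K, (gA j) ^ 3 / 2 * C :=
          Finset.sum_le_sum fun j hj => he_le j (Finset.mem_range.mp hj).le
      _ = C / 2 * ∑ j ∈ range K, (gA j) ^ 3 := by rw [Finset.mul_sum]; exact Finset.sum_congr rfl fun j _ => by ring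
      _ ≤ C / 2 * (2 * γ / b) := by
          refine mul_le_mul_of_nonneg_left ?_ (by positivity)
          calc ∑ i ∈ range K, (gA i) ^ 3 ≤ ∑ i ∈ range K, 1 / (sprof γ b (K - i)) ^ 2 * (1 / sprof γ b (K - i)) :=
                Finset.sum_le_sum fun i hi => cube_le_weight hγ hb hA hAbox hlo (Finset.mem_range.mp hi).le
            _ ≤ 2 * γ / b := sum_weights_lt_le hγ hb K
      _ = γ / b * C := by ring
  calc ∑ j ∈ range K, E j ≤ ∑ j ∈ range K, ((d j - d (j + 1)) + W * e j) :=
        Finset.sum_le_sum fun j hj => hstep j (Finset.mem_range.mp hj)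
    _ = (d 0 - d K) + W * ∑ j ∈ range K, e j := by rw [Finset.sum_add_distrib, htel, Finset.mul_sum]
    _ ≤ d 0 + W * (γ / b * C) := by rw [hdK, sub_zero]; exact add_le_add le_rfl (mul_le_mul_of_nonneg_left hsum_e hW)
    _ = (1 / (gB n) ^ 2 - 1 / (gA 0) ^ 2) + W * γ / b * C := by simp only [hd, Nat.zero_add]; ring

end Summit.QuantumFields.BalabanUV.Beta.RemainderExplicitHistoryDiagonalTwoRun

end
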